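import Literature.Computability.Complexity.MatchingExtensionComplexityProofs
import HarnessLib

/-!
# Rothvoss's partitions as bijections from a template (set-up for Lemma 7 of Rothvoss 2017)

Infrastructure for the formalisation of the main technical lemma (Lemma 7, §3) of T. Rothvoss,
*The matching polytope has exponential extension complexity*, J. ACM 64 (2017) 41. The paper works
with *partitions* `T = (A₁ ∪̇ … ∪̇ A_m, C, D, B₁ ∪̇ … ∪̇ B_m)` of the `n = 3m(k-3) + 2k` vertices
(`|Aᵢ| = k-3`, `|C| = |D| = k`, `|Bᵢ| = 2(k-3)`, §3.1) together with a `3`-matching `H ⊆ C × D` and a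
`k`-matching `F ⊆ C × D` (§3.2), all chosen uniformly at random.

**Design (this tree).** A pair (partition, `H`) is encoded by a bijection `τ : TV k m ≃ Fin n` from
a fixed *template* vertex type `TV k m` whose constructors ARE the blocks: `a i x` (block `Aᵢ`),
`cr x` (`C ∖ V(H)`), `ch j`, `dh j` (the three `H`-edges are `{ch j, dh j}`), `dr x` (`D ∖ V(H)`),
`b i x` (block `Bᵢ`). Averages over uniformly random `(T, H)` (resp. `(T, F)`, with the template
`k`-matching `F₀ = {ch j ↔ dh j} ∪ {cr x ↔ dr x}`) are averages over all `τ`, since every `(T, H)`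
has the same number of encodings; no partition is ever counted. Perfect matchings are handled as
*partner maps* (fixed-point-free involutions, `Literature.Probability.LatticeModels.partnerSubgraph`),
on the template as maps `f : TV k m → TV k m`, transported along `τ` (`xport`, `toSub`), and cuts
as images `U₀.map τ` of template cuts.

This file provides: the template type and its cardinality (`card_TV : |TV k m| = rvN k m`), block
labels (`lab`), transport of template matchings to perfect matchings of `K_n` (`toSub`,
`toSub_isPerfectMatching`) with the crossing number computed on the template (`crossing_xport`),
the template cuts `cut₀ I = ch ∪ ⋃_{i ∈ I} Aᵢ` / `cutk₀ I = C ∪ ⋃_{i ∈ I} Aᵢ` and their sizes, the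
template matching families `mats₀` (containing `H₀`, preserving every `Aᵢ`, `Bᵢ`, `cr`, `dr` — the
matchings "`M ∈ 𝓜_all(T)` with `M ∩ (C × D) = H`" of §3.2) and `matsk₀` (containing `F₀`,
preserving every `Aᵢ`, `Bᵢ`), the crossing counts `|δ(U) ∩ M| = 3`, resp. `= k`, on
`cuts × matchings` of the two kinds (the statement "`(U, M) ∈ Q₃`", resp. "`∈ Q_k`", of §3.2), and
non-emptiness of all four families (explicit members built from `Rothvoss.padMap`).

## References

* T. Rothvoss, *The matching polytope has exponential extension complexity*, J. ACM 64(6) (2017)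
  41:1–41:19, §3.1–§3.2 [Rothvoss2017].
-/

namespace Literature.Computability.Complexity

open Finset
open Literature.Probability.LatticeModels

namespace Rothvoss

/-! ### The template vertex type -/

/-- **Template vertices** for Rothvoss's partitions with a distinguished `3`-matching `H₀`
(Rothvoss 2017, §3.1–3.2): `a i x` — the `x`-th vertex of block `Aᵢ` (`|Aᵢ| = k-3`); `cr x` — the
vertices of `C` not covered by `H₀`; `ch j`, `dh j` — the endpoints of the `j`-th edge of `H₀`
(`j < 3`) in `C`, resp. `D`; `dr x` — the vertices of `D` not covered by `H₀`; `b i x` — block `Bᵢ`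
(`|Bᵢ| = 2(k-3)`). [cite: Rothvoss2017, §3.1] -/
inductive TV (k m : ℕ) : Type
  | a (i : Fin m) (x : Fin (k - 3)) : TV k m
  | cr (x : Fin (k - 3)) : TV k m
  | ch (j : Fin 3) : TV k m
  | dh (j : Fin 3) : TV k m
  | dr (x : Fin (k - 3)) : TV k m
  | b (i : Fin m) (x : Fin (2 * (k - 3))) : TV k m
  deriving DecidableEq, Fintype

/-- The template has `n = 3m(k-3) + 2k` vertices (`k ≥ 3`). [cite: Rothvoss2017, §3.1] -/
theorem card_TV {k : ℕ} (m : ℕ) (hk : 3 ≤ k) : Fintype.card (TV k m) = rvN k m := by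
  rw [← Fintype.card_congr (proxy_equiv% (TV k m))]
  obtain ⟨j, rfl⟩ : ∃ j, k = j + 3 := ⟨k - 3, by omega⟩
  simp [rvN]
  ring

/-- Block labels of template vertices. [cite: Rothvoss2017, §3.1] -/
inductive Lab (m : ℕ) : Type
  | A (i : Fin m) : Lab m
  | CR : Lab m
  | CH : Lab m
  | DH : Lab m
  | DR : Lab m
  | B (i : Fin m) : Lab m
  deriving DecidableEq

variable {k m n : ℕ}

/-- The block label of a template vertex. [cite: Rothvoss2017, §3.1] -/
def lab : TV k m → Lab m
  | .a i _ => .A i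
  | .cr _ => .CR
  | .ch _ => .CH
  | .dh _ => .DH
  | .dr _ => .DR
  | .b i _ => .B i

/-- The small blocks `Aᵢ`, `Bᵢ` (those a matching "respecting the partition" must preserve
individually in both the `Q₃`- and the `Q_k`-sampling). [cite: Rothvoss2017, §3.1] -/
def Lab.isSmall : Lab m → Bool
  | .A _ => true
  | .B _ => true
  | _ => false

/-- A vertex with label `A i` is in block `Aᵢ`. [folklore] -/
theorem lab_eq_A_iff {v : TV k m} {i : Fin m} : lab v = Lab.A i ↔ ∃ x, v = TV.a i x := by
  cases v <;> simp [lab]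

/-! ### Transport of template matchings along a bijection -/

/-- Transport of a template self-map `f` along `τ : TV k m ≃ Fin n`: `τ ∘ f ∘ τ⁻¹`. [folklore] -/
def xport (τ : TV k m ≃ Fin n) (f : TV k m → TV k m) : Fin n → Fin n := fun v => τ (f (τ.symm v))

/-- `(τ f τ⁻¹)(τ x) = τ (f x)`. [folklore] -/
@[simp] theorem xport_apply (τ : TV k m ≃ Fin n) (f : TV k m → TV k m) (x : TV k m) :
    xport τ f (τ x) = τ (f x) := by
  simp [xport]

/-- The transport of a fixed-point-free involution is an adjacency-respecting involution of `K_n`.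
[folklore] -/
theorem xport_spec (τ : TV k m ≃ Fin n) {f : TV k m → TV k m}
    (hf : ∀ v, f v ≠ v ∧ f (f v) = v) (v : Fin n) :
    (⊤ : SimpleGraph (Fin n)).Adj v (xport τ f v) ∧ xport τ f (xport τ f v) = v := by
  refine ⟨(SimpleGraph.top_adj _ _).2 fun h => ?_, by simp [xport, (hf _).2]⟩
  have h' := congrArg τ.symm h
  simp only [xport, Equiv.symm_apply_apply] at h'
  exact (hf _).1 h'.symm

/-- The perfect matching of `K_n` obtained by transporting a template partner map `f` along `τ`
(junk value `⊥` if `f` is not a fixed-point-free involution). [folklore] -/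
def toSub (τ : TV k m ≃ Fin n) (f : TV k m → TV k m) : (⊤ : SimpleGraph (Fin n)).Subgraph :=
  if hf : ∀ v, f v ≠ v ∧ f (f v) = v then partnerSubgraph ⊤ (xport τ f) (xport_spec τ hf) else ⊥

/-- `toSub` of a partner map, unfolded. [folklore] -/
theorem toSub_eq (τ : TV k m ≃ Fin n) {f : TV k m → TV k m} (hf : ∀ v, f v ≠ v ∧ f (f v) = v) :
    toSub τ f = partnerSubgraph ⊤ (xport τ f) (xport_spec τ hf) :=
  dif_pos hf

/-- The transported matching is a perfect matching of `K_n`. [folklore] -/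
theorem toSub_isPerfectMatching (τ : TV k m ≃ Fin n) {f : TV k m → TV k m}
    (hf : ∀ v, f v ≠ v ∧ f (f v) = v) : (toSub τ f).IsPerfectMatching := by
  rw [toSub_eq τ hf]
  exact partnerSubgraph_isPerfectMatching _ _ _

/-- **Crossing numbers are computed on the template**: for a template cut `U₀` and a template
partner map `f`, `|δ(τ U₀) ∩ (τ f τ⁻¹)| = #{x ∈ U₀ : f x ∉ U₀}`. [folklore] -/
theorem crossing_xport (τ : TV k m ≃ Fin n) {f : TV k m → TV k m}
    (hf : ∀ v, f v ≠ v ∧ f (f v) = v) (U₀ : Finset (TV k m)) :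
    crossing (U₀.map τ.toEmbedding) (toSub τ f) = (U₀.filter fun x => f x ∉ U₀).card := by
  classical
  rw [toSub_eq τ hf, crossing_eq_card_filter _ (partnerSubgraph_isPerfectMatching _ _ _),
    filter_map, card_map]
  congr 1
  refine filter_congr fun x _ => ?_
  simp only [Function.comp_apply, matchPartner_partnerSubgraph, Equiv.coe_toEmbedding,
    xport_apply, mem_map_equiv, Equiv.symm_apply_apply]

/-! ### Template cuts -/

/-- Membership in the template cut `ch ∪ ⋃_{i ∈ I} Aᵢ` (a cut `U ∈ 𝓤_all(T)` with `U ∩ C = V(H) ∩ C`,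
§3.2). [cite: Rothvoss2017, §3.2] -/
def cutMem (I : Finset (Fin m)) : TV k m → Bool
  | .ch _ => true
  | .a i _ => decide (i ∈ I)
  | _ => false

/-- The template cut `ch ∪ ⋃_{i ∈ I} Aᵢ`. [cite: Rothvoss2017, §3.2] -/
def cut₀ (I : Finset (Fin m)) : Finset (TV k m) := univ.filter fun v => cutMem I v = true

/-- Membership in the template cut `C ∪ ⋃_{i ∈ I} Aᵢ` (a cut with `U ∩ C = C`, §3.2).
[cite: Rothvoss2017, §3.2] -/
def cutkMem (I : Finset (Fin m)) : TV k m → Bool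
  | .ch _ => true
  | .cr _ => true
  | .a i _ => decide (i ∈ I)
  | _ => false

/-- The template cut `C ∪ ⋃_{i ∈ I} Aᵢ`. [cite: Rothvoss2017, §3.2] -/
def cutk₀ (I : Finset (Fin m)) : Finset (TV k m) := univ.filter fun v => cutkMem I v = true

variable (k m) in
/-- All template cuts with `U ∩ C = V(H) ∩ C`: `(m+1)/2` of the `m` blocks `Aᵢ` (so that
`|U| = t = (m+1)/2 · (k-3) + 3`). [cite: Rothvoss2017, §3.2] -/
def cuts₀ : Finset (Finset (TV k m)) := (univ.powersetCard ((m + 1) / 2)).image cut₀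

variable (k m) in
/-- All template cuts with `U ∩ C = C`: `(m-1)/2` of the blocks `Aᵢ`. [cite: Rothvoss2017, §3.2] -/
def cutsk₀ : Finset (Finset (TV k m)) := (univ.powersetCard ((m - 1) / 2)).image cutk₀

/-- Membership in `cut₀ I`, unfolded. [folklore] -/
@[simp] theorem mem_cut₀ {I : Finset (Fin m)} {v : TV k m} : v ∈ cut₀ I ↔ cutMem I v = true := by
  simp [cut₀]

/-- Membership in `cutk₀ I`, unfolded. [folklore] -/
@[simp] theorem mem_cutk₀ {I : Finset (Fin m)} {v : TV k m} : v ∈ cutk₀ I ↔ cutkMem I v = true := by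
  simp [cutk₀]

/-- The `H₀`-part `{ch 0, ch 1, ch 2}` of `C`. [cite: Rothvoss2017, §3.2] -/
def chSet : Finset (TV k m) := univ.map ⟨TV.ch, fun _ _ h => by cases h; rfl⟩

/-- The remainder `cr` of `C`. [cite: Rothvoss2017, §3.2] -/
def crSet : Finset (TV k m) := univ.map ⟨TV.cr, fun _ _ h => by cases h; rfl⟩

/-- The block `Aᵢ`. [cite: Rothvoss2017, §3.1] -/
def aSet (i : Fin m) : Finset (TV k m) := univ.map ⟨TV.a i, fun _ _ h => by cases h; rfl⟩

/-- `|ch| = 3`. [folklore] -/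
theorem card_chSet : (chSet : Finset (TV k m)).card = 3 := by simp [chSet]

/-- `|cr| = k - 3`. [folklore] -/
theorem card_crSet : (crSet : Finset (TV k m)).card = k - 3 := by simp [crSet]

/-- `|Aᵢ| = k - 3`. [folklore] -/
theorem card_aSet (i : Fin m) : (aSet i : Finset (TV k m)).card = k - 3 := by simp [aSet]

/-- `cut₀ I = ch ∪ ⋃_{i ∈ I} Aᵢ` as a disjoint union. [cite: Rothvoss2017, §3.2] -/
theorem cut₀_eq (I : Finset (Fin m)) : (cut₀ I : Finset (TV k m)) = chSet ∪ I.biUnion aSet := by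
  ext v
  cases v <;> simp [cutMem, chSet, aSet]

/-- `cutk₀ I = ch ∪ cr ∪ ⋃_{i ∈ I} Aᵢ`. [cite: Rothvoss2017, §3.2] -/
theorem cutk₀_eq (I : Finset (Fin m)) :
    (cutk₀ I : Finset (TV k m)) = (chSet ∪ crSet) ∪ I.biUnion aSet := by
  ext v
  cases v <;> simp [cutkMem, chSet, crSet, aSet]

/-- `|ch ∪ ⋃_{i ∈ I} Aᵢ| = 3 + |I| (k-3)`. [cite: Rothvoss2017, §3.2] -/
theorem card_cut₀ (I : Finset (Fin m)) : (cut₀ I : Finset (TV k m)).card = 3 + I.card * (k - 3) := by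
  rw [cut₀_eq, card_union_of_disjoint, card_chSet, card_biUnion]
  · simp [card_aSet]
  · intro i _ j _ hij
    rw [Function.onFun, disjoint_left]
    intro v hv hv'
    simp only [aSet, mem_map, mem_univ, Function.Embedding.coeFn_mk, true_and] at hv hv'
    obtain ⟨x, rfl⟩ := hv
    obtain ⟨y, hy⟩ := hv'
    cases hy
    exact hij rfl
  · rw [disjoint_left]
    intro v hv hv'
    simp only [chSet, mem_map, mem_univ, Function.Embedding.coeFn_mk, true_and] at hv
    obtain ⟨j, rfl⟩ := hv
    simp [aSet] at hv'

/-- `|C ∪ ⋃_{i ∈ I} Aᵢ| = k + |I| (k-3)` (`k ≥ 3`). [cite: Rothvoss2017, §3.2] -/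
theorem card_cutk₀ (hk : 3 ≤ k) (I : Finset (Fin m)) :
    (cutk₀ I : Finset (TV k m)).card = k + I.card * (k - 3) := by
  rw [cutk₀_eq, card_union_of_disjoint, card_union_of_disjoint, card_chSet, card_crSet,
    card_biUnion]
  · simp [card_aSet]
    omega
  · intro i _ j _ hij
    rw [Function.onFun, disjoint_left]
    intro v hv hv'
    simp only [aSet, mem_map, mem_univ, Function.Embedding.coeFn_mk, true_and] at hv hv'
    obtain ⟨x, rfl⟩ := hv
    obtain ⟨y, hy⟩ := hv'
    cases hy
    exact hij rfl
  · rw [disjoint_left]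
    intro v hv hv'
    simp only [chSet, mem_map, mem_univ, Function.Embedding.coeFn_mk, true_and] at hv
    obtain ⟨j, rfl⟩ := hv
    simp [crSet] at hv'
  · rw [disjoint_left]
    intro v hv hv'
    simp only [mem_union, chSet, crSet, mem_map, mem_univ, Function.Embedding.coeFn_mk,
      true_and] at hv
    rcases hv with ⟨j, rfl⟩ | ⟨x, rfl⟩ <;> simp [aSet] at hv'

/-! ### Template matchings -/

variable (k m) in
/-- **Template matchings for `Q₃`-sampling**: fixed-point-free involutions `f` of the template
containing `H₀` (`f (ch j) = dh j`) and preserving every block `Aᵢ`, `Bᵢ` and the remainders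
`cr`, `dr` of `C` and `D` — i.e. the matchings `M ∈ 𝓜_all(T)` with `M ∩ (C × D) = H` of §3.2,
read on the template. [cite: Rothvoss2017, §3.2] -/
def mats₀ : Finset (TV k m → TV k m) :=
  univ.filter fun f => (∀ v, f v ≠ v ∧ f (f v) = v) ∧ (∀ j, f (.ch j) = .dh j) ∧
    ∀ v, lab v ≠ Lab.CH → lab v ≠ Lab.DH → lab (f v) = lab v

variable (k m) in
/-- **Template matchings for `Q_k`-sampling**: fixed-point-free involutions containing the
template `k`-matching `F₀ = {ch j ↔ dh j} ∪ {cr x ↔ dr x}` between `C` and `D` and preserving every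
block `Aᵢ`, `Bᵢ` (§3.2: "pick a random `k`-matching `F` in `C × D`, then randomly extend").
[cite: Rothvoss2017, §3.2] -/
def matsk₀ : Finset (TV k m → TV k m) :=
  univ.filter fun f => (∀ v, f v ≠ v ∧ f (f v) = v) ∧ (∀ j, f (.ch j) = .dh j) ∧
    (∀ x, f (.cr x) = .dr x) ∧ ∀ v, (lab v).isSmall = true → lab (f v) = lab v

/-- Membership in `mats₀`, unfolded. [cite: Rothvoss2017, §3.2] -/
theorem mem_mats₀ {f : TV k m → TV k m} : f ∈ mats₀ k m ↔
    (∀ v, f v ≠ v ∧ f (f v) = v) ∧ (∀ j, f (.ch j) = .dh j) ∧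
      ∀ v, lab v ≠ Lab.CH → lab v ≠ Lab.DH → lab (f v) = lab v := by
  simp [mats₀]

/-- Membership in `matsk₀`, unfolded. [cite: Rothvoss2017, §3.2] -/
theorem mem_matsk₀ {f : TV k m → TV k m} : f ∈ matsk₀ k m ↔
    (∀ v, f v ≠ v ∧ f (f v) = v) ∧ (∀ j, f (.ch j) = .dh j) ∧
      (∀ x, f (.cr x) = .dr x) ∧ ∀ v, (lab v).isSmall = true → lab (f v) = lab v := by
  simp [matsk₀]

/-- A `Q₃`-template matching maps block `Aᵢ` to itself. [cite: Rothvoss2017, §3.2] -/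
theorem mats₀_a {f : TV k m → TV k m} (hf : f ∈ mats₀ k m) (i : Fin m) (x : Fin (k - 3)) :
    ∃ y, f (.a i x) = .a i y :=
  lab_eq_A_iff.1 ((mem_mats₀.1 hf).2.2 (.a i x) (by simp [lab]) (by simp [lab]))

/-- A `Q_k`-template matching maps block `Aᵢ` to itself. [cite: Rothvoss2017, §3.2] -/
theorem matsk₀_a {f : TV k m → TV k m} (hf : f ∈ matsk₀ k m) (i : Fin m) (x : Fin (k - 3)) :
    ∃ y, f (.a i x) = .a i y :=
  lab_eq_A_iff.1 ((mem_matsk₀.1 hf).2.2.2 (.a i x) (by simp [lab, Lab.isSmall]))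

/-- **`(U, M) ∈ Q₃`**: a `Q₃`-template cut and a `Q₃`-template matching cross in exactly the three
edges of `H₀`. [cite: Rothvoss2017, §3.2] -/
theorem crossing_cut₀_mats₀ (I : Finset (Fin m)) {f : TV k m → TV k m} (hf : f ∈ mats₀ k m) :
    ((cut₀ I).filter fun x => f x ∉ cut₀ I).card = 3 := by
  have hH := (mem_mats₀.1 hf).2.1
  suffices h : ((cut₀ I).filter fun x => f x ∉ cut₀ I) = (chSet : Finset (TV k m)) by
    rw [h, card_chSet]
  ext v
  simp only [mem_filter, mem_cut₀, chSet, mem_map, mem_univ, Function.Embedding.coeFn_mk,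
    true_and]
  constructor
  · rintro ⟨hv, hfv⟩
    cases v with
    | ch j => exact ⟨j, rfl⟩
    | a i x =>
      obtain ⟨y, hy⟩ := mats₀_a hf i x
      simp [cutMem, hy] at hv hfv
      exact absurd hv hfv
    | _ => simp [cutMem] at hv
  · rintro ⟨j, rfl⟩
    simp [cutMem, hH]

/-- **`(U, M) ∈ Q_k`**: a `Q_k`-template cut and a `Q_k`-template matching cross in exactly the `k`
edges of `F₀` (`k ≥ 3`). [cite: Rothvoss2017, §3.2] -/
theorem crossing_cutk₀_matsk₀ (hk : 3 ≤ k) (I : Finset (Fin m)) {f : TV k m → TV k m}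
    (hf : f ∈ matsk₀ k m) : ((cutk₀ I).filter fun x => f x ∉ cutk₀ I).card = k := by
  have hH := (mem_matsk₀.1 hf).2.1
  have hF := (mem_matsk₀.1 hf).2.2.1
  suffices h : ((cutk₀ I).filter fun x => f x ∉ cutk₀ I) = (chSet ∪ crSet : Finset (TV k m)) by
    rw [h, card_union_of_disjoint, card_chSet, card_crSet]
    · omega
    · rw [disjoint_left]
      intro v hv hv'
      simp only [chSet, mem_map, mem_univ, Function.Embedding.coeFn_mk, true_and] at hv
      obtain ⟨j, rfl⟩ := hv
      simp [crSet] at hv'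
  ext v
  simp only [mem_filter, mem_cutk₀, mem_union, chSet, crSet, mem_map, mem_univ,
    Function.Embedding.coeFn_mk, true_and]
  constructor
  · rintro ⟨hv, hfv⟩
    cases v with
    | ch j => exact Or.inl ⟨j, rfl⟩
    | cr x => exact Or.inr ⟨x, rfl⟩
    | a i x =>
      obtain ⟨y, hy⟩ := matsk₀_a hf i x
      simp [cutkMem, hy] at hv hfv
      exact absurd hv hfv
    | _ => simp [cutkMem] at hv
  · rintro (⟨j, rfl⟩ | ⟨x, rfl⟩)
    · simp [cutkMem, hH]
    · simp [cutkMem, hF]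

/-! ### Non-emptiness: explicit template matchings -/

/-- The pairing `0 ↔ 1, 2 ↔ 3, …` of `Fin s` for even `s` (`Rothvoss.padMap` over the empty map).
[folklore] -/
def pairFin (s : ℕ) (hs : s % 2 = 0) : Fin s → Fin s :=
  padMap (n₀ := 0) (Nat.zero_le s) (by simpa using hs) Fin.elim0

/-- `pairFin` is a fixed-point-free involution. [folklore] -/
theorem pairFin_spec (s : ℕ) (hs : s % 2 = 0) (x : Fin s) :
    pairFin s hs x ≠ x ∧ pairFin s hs (pairFin s hs x) = x := by
  have h := padMap_spec (n₀ := 0) (Nat.zero_le s) (by simpa using hs) Fin.elim0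
    (fun v => v.elim0) x
  exact ⟨fun heq => (SimpleGraph.top_adj _ _).1 h.1 heq.symm, h.2⟩

/-- For odd `k`, `k - 3` is even. [folklore] -/
theorem sub_three_mod_two (hk : Odd k) : (k - 3) % 2 = 0 := by
  obtain ⟨j, rfl⟩ := hk
  omega

/-- For odd `k`, `2(k - 3)` is even. [folklore] -/
theorem two_mul_sub_three_mod_two (k : ℕ) : (2 * (k - 3)) % 2 = 0 := by
  omega

/-- An explicit `Q₃`-template matching: `H₀` on `ch/dh`, consecutive pairs inside every other
block. [cite: Rothvoss2017, §3.2] -/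
def fEx₃ (hk : Odd k) : TV k m → TV k m
  | .a i x => .a i (pairFin _ (sub_three_mod_two hk) x)
  | .cr x => .cr (pairFin _ (sub_three_mod_two hk) x)
  | .ch j => .dh j
  | .dh j => .ch j
  | .dr x => .dr (pairFin _ (sub_three_mod_two hk) x)
  | .b i x => .b i (pairFin _ (two_mul_sub_three_mod_two k) x)

/-- An explicit `Q_k`-template matching: `F₀` on `C ∪ D`, consecutive pairs inside `Aᵢ`, `Bᵢ`.
[cite: Rothvoss2017, §3.2] -/
def fExk (hk : Odd k) : TV k m → TV k m
  | .a i x => .a i (pairFin _ (sub_three_mod_two hk) x)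
  | .cr x => .dr x
  | .ch j => .dh j
  | .dh j => .ch j
  | .dr x => .cr x
  | .b i x => .b i (pairFin _ (two_mul_sub_three_mod_two k) x)

/-- The explicit `Q₃`-template matching qualifies. [cite: Rothvoss2017, §3.2] -/
theorem fEx₃_mem (hk : Odd k) : (fEx₃ hk : TV k m → TV k m) ∈ mats₀ k m := by
  refine mem_mats₀.2 ⟨fun v => ?_, fun j => rfl, fun v h1 h2 => ?_⟩
  · cases v <;> simp [fEx₃, pairFin_spec]
  · cases v <;> simp [fEx₃, lab] at h1 h2 ⊢

/-- The explicit `Q_k`-template matching qualifies. [cite: Rothvoss2017, §3.2] -/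
theorem fExk_mem (hk : Odd k) : (fExk hk : TV k m → TV k m) ∈ matsk₀ k m := by
  refine mem_matsk₀.2 ⟨fun v => ?_, fun j => rfl, fun x => rfl, fun v hv => ?_⟩
  · cases v <;> simp [fExk, pairFin_spec]
  · cases v <;> simp [fExk, lab, Lab.isSmall] at hv ⊢

/-- `mats₀` is non-empty (odd `k`). [cite: Rothvoss2017, §3.2] -/
theorem mats₀_nonempty (hk : Odd k) : (mats₀ k m).Nonempty := ⟨_, fEx₃_mem hk⟩

/-- `matsk₀` is non-empty (odd `k`). [cite: Rothvoss2017, §3.2] -/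
theorem matsk₀_nonempty (hk : Odd k) : (matsk₀ k m).Nonempty := ⟨_, fExk_mem hk⟩

/-- `cuts₀` is non-empty. [cite: Rothvoss2017, §3.2] -/
theorem cuts₀_nonempty : (cuts₀ k m).Nonempty := by
  refine (Finset.image_nonempty).2 (powersetCard_nonempty.2 ?_)
  rw [card_univ, Fintype.card_fin]
  omega

/-- `cutsk₀` is non-empty. [cite: Rothvoss2017, §3.2] -/
theorem cutsk₀_nonempty : (cutsk₀ k m).Nonempty := by
  refine (Finset.image_nonempty).2 (powersetCard_nonempty.2 ?_)
  rw [card_univ, Fintype.card_fin]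
  omega

/-- Every `Q₃`-template cut has `t = rvT k m` vertices. [cite: Rothvoss2017, §3.2] -/
theorem card_of_mem_cuts₀ {U₀ : Finset (TV k m)} (hU : U₀ ∈ cuts₀ k m) :
    U₀.card = rvT k m := by
  obtain ⟨I, hI, rfl⟩ := mem_image.1 hU
  rw [card_cut₀, (mem_powersetCard.1 hI).2, rvT]
  ring

/-- Every `Q_k`-template cut has `t = rvT k m` vertices (`m` odd, `k ≥ 3`).
[cite: Rothvoss2017, §3.2] -/
theorem card_of_mem_cutsk₀ (hk : 3 ≤ k) (hm : Odd m) {U₀ : Finset (TV k m)}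
    (hU : U₀ ∈ cutsk₀ k m) : U₀.card = rvT k m := by
  obtain ⟨I, hI, rfl⟩ := mem_image.1 hU
  rw [card_cutk₀ hk, (mem_powersetCard.1 hI).2, rvT]
  obtain ⟨j, rfl⟩ := hm
  obtain ⟨l, rfl⟩ : ∃ l, k = l + 3 := ⟨k - 3, by omega⟩
  have e1 : (2 * j + 1 - 1) / 2 = j := by omega
  have e2 : (2 * j + 1 + 1) / 2 = j + 1 := by omega
  rw [e1, e2]
  simp
  ring

end Rothvoss

end Literature.Computability.Complexity
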